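import Literature.AnabelianGeometry.AbsoluteAnabelian.CuspInertiaFreeProcyclicProfinite
import Literature.AnabelianGeometry.AbsoluteAnabelian.AbsTopIChainsCuspidalFacts
import HarnessLib

/-!
# [AbsTopI] Lem. 4.5 (vi) / [AbsAnab] Lem. 1.3.7 / [AbsTopIII] Thm. 1.11 (b) at the genuine surface-group
# carrier: `C_Π(I_x) = N_Π(I_x) = I_x = D_x` for the cusps of a pro-`Σ` completion of `Γ_{g,r}`

Mochizuki, *Topics in Absolute Anabelian Geometry I*, Lemma 4.5 (vi) p. 55 ("Let `I ⊆ Π` be a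
decomposition group of a cusp. Then `I = C_Π(I ∩ Δ)`"); *The Absolute Anabelian Geometry of Hyperbolic
Curves*, Lemma 1.3.7 p. 18 ("`I_x ⊆ Δ_X` is commensurably terminal"); *Topics … III*, Thm. 1.11 (b) p. 46
("`D_x` … may then be constructed as the normalizer … of `I_x`").  The cell types these as the predicates
`CuspidalData.DecompEqCommensuratorOfInertia` (FACT-LIST F-0207), `CuspidalData.InertiaCommensurablyTerminal`
(F-0003), `CuspidalData.DecompEqNormalizer` (F-0405) on abstract cuspidal data (universal closures
REFUTED; joint instance of record at `Π = G × F̂₂` with one hand-placed cusp,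
`CuspidalData.exists_prod_freeTwo_model`, abc-iut-f-060; structure theorem
`CuspidalData.decompEqCommensuratorOfInertia_iff : F-0207 ↔ F-0003 ∧ F-0405`).

This PROOF-ONLY file (no definitions) adds the instance at the GENUINE SURFACE-GROUP CARRIER OF EVERY
HYPERBOLIC TYPE `(g, r)` (the cuspidal data of `CuspInertiaFreeProcyclicProfinite.lean`: `Π = P` a
pro-`Σ` completion `ι : Γ_{g,r} → P`, `G = 1`, cusps `Fin r`, `D_j = I_j = cl ι⟨c_j⟩`).  The group theory is
the MALNORMALITY of cusp inertia in pro-`Σ` surface groups (`proSigmaCuspInertiaMalnormal_holds`, abc-iut-L3: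
`I_j ∩ x I_j x⁻¹ = 1` for `x ∉ I_j`, `I_j` infinite), through the abstract lemma
`commensurator_eq_self_of_malnormal` (§1: an infinite malnormal subgroup is its own commensurator — a
conjugate meeting `H` trivially has relative index `|H| = ∞`, i.e. `relIndex = 0`):

* `commensurator_cuspInertia_closure_eq` — **`C_P(I_j) = I_j`** for EVERY nonempty set of primes `Σ`
  ([AbsTopI] Lem. 4.5 (vi) / [AbsAnab] Lem. 1.3.7 at the carrier, in `P`);
* `FundamentalExtension.CuspidalData.exists_surfaceGroup_cuspidalQuartet` — at the PROFINITE completion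
  (`Σ = 𝔓𝔯𝔦𝔪𝔢𝔰`) the genuine cuspidal datum satisfies ALL FOUR typed rows
  **F-0406 ∧ F-0207 ∧ F-0003 ∧ F-0405** (`InertiaFreeProcyclic`, `DecompEqCommensuratorOfInertia`,
  `InertiaCommensurablyTerminal`, `DecompEqNormalizer`), and `…_of_isHyperbolicType` — such a carrier
  exists for every hyperbolic `(g, r)`.

HONEST LABEL: group-theoretic carriers (pro-`Σ` completions of topological `π₁`'s, `G = 1`, so
`D_x = I_x`: the Galois part of print's `D_x` is absent by construction), not the étale `π₁` of a curve
over an MLF; instance ≠ endorsement; nothing here bears on [IUTchIII] Cor. 3.12; typed ≠ proved.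
-/

noncomputable section

open scoped Pointwise

namespace Literature.AnabelianGeometry.AbsoluteAnabelian

open Literature.GroupTheory.CombinatorialGroupTheory
open Literature.AnabelianGeometry.SemiGraphs
open Literature.AnabelianGeometry.SemiGraphs.SemiGraphOfAnabelioids (IsProSigmaCompletion)

universe v

/-! ### §1 An infinite malnormal subgroup is its own commensurator -/

section Malnormal

variable {G : Type*} [Group G]

/-- `x • H = H` for `x ∈ H` (conjugation action). [folklore] -/
private theorem toConjAct_smul_eq_self_of_mem (H : Subgroup G) {x : G} (hx : x ∈ H) :
    ConjAct.toConjAct x • H = H := by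
  ext y
  rw [Subgroup.mem_pointwise_smul_iff_inv_smul_mem, ← ConjAct.toConjAct_inv, ConjAct.toConjAct_smul,
    inv_inv, H.mul_mem_cancel_right hx, H.mul_mem_cancel_left (H.inv_mem hx)]

/-- **An infinite malnormal subgroup is its own commensurator**: if `H ∩ x H x⁻¹ = 1` for every
`x ∉ H` and `H` is infinite, then `C_G(H) = H` — for `x ∉ H` the relative index of `x H x⁻¹` in `H` is
`[H : 1] = ∞`, recorded as `relIndex = 0`, so the two are not commensurable (the group theory of
[AbsAnab] Lem. 1.3.7 "`I_x` is commensurably terminal"). [cite: MochizukiAbsAnab2004, Lemma 1.3.7 p.18] -/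
theorem commensurator_eq_self_of_malnormal (H : Subgroup G) [Infinite H]
    (hmal : ∀ x : G, x ∉ H → H ⊓ ConjAct.toConjAct x • H = ⊥) :
    Subgroup.Commensurable.commensurator H = H := by
  ext x
  rw [Subgroup.Commensurable.commensurator_mem_iff]
  refine ⟨fun hc => ?_, fun hx => ?_⟩
  · by_contra hx
    apply hc.1
    have hbot : (ConjAct.toConjAct x • H).subgroupOf H = ⊥ := by
      rw [Subgroup.subgroupOf_eq_bot, disjoint_iff, inf_comm]
      exact hmal x hx
    show ((ConjAct.toConjAct x • H).subgroupOf H).index = 0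
    rw [hbot, Subgroup.index_bot]
    exact Nat.card_eq_zero_of_infinite
  · rw [toConjAct_smul_eq_self_of_mem H hx]

end Malnormal

/-! ### §2 Cusp inertia in a pro-`Σ` completion of `Γ_{g,r}` is its own commensurator -/

variable {P : Type v} [Group P] [TopologicalSpace P] [IsTopologicalGroup P] [CompactSpace P] [T2Space P]
  [TotallyDisconnectedSpace P] {g r : ℕ}

/-- **`C_P(I_j) = I_j`** for the closed cusp inertia subgroups `I_j = cl ι⟨c_j⟩` of a pro-`Σ` completion
`ι : Γ_{g,r} → P` of a hyperbolic punctured surface group, `Σ` any nonempty set of primes ([AbsTopI]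
Lem. 4.5 (vi) "`I = C_Π(I ∩ Δ)`" / [AbsAnab] Lem. 1.3.7 "commensurably terminal", at `G = 1`): from the
malnormality and infinitude of cusp inertia (`proSigmaCuspInertiaMalnormal_holds`).
[cite: MochizukiAbsTopI2012, Lemma 4.5 (vi) p.55] -/
theorem commensurator_cuspInertia_closure_eq {Sigma : Set ℕ} (hS : Sigma.Nonempty)
    (hSp : ∀ p ∈ Sigma, p.Prime) (h : PuncturedSurfaceGroup.IsHyperbolicType g r)
    (ι : PuncturedSurfaceGroup g r →* P) (hι : IsProSigmaCompletion Sigma ι) (j : Fin r) :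
    Subgroup.Commensurable.commensurator ((PuncturedSurfaceGroup.cuspInertia (g := g) j).map ι).topologicalClosure
      = ((PuncturedSurfaceGroup.cuspInertia (g := g) j).map ι).topologicalClosure := by
  have hmal := SemiGraphOfAnabelioids.proSigmaCuspInertiaMalnormal_holds.{v} Sigma hS hSp g r h P ι hι j j
  haveI : Infinite ↥((PuncturedSurfaceGroup.cuspInertia (g := g) j).map ι).topologicalClosure := hmal.1
  exact commensurator_eq_self_of_malnormal _ fun x hx => hmal.2 x (Or.inr hx)

/-! ### §3 The quartet F-0406 ∧ F-0207 ∧ F-0003 ∧ F-0405 at the genuine surface-group cuspidal data -/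

/-- **F-0406 ∧ F-0207 ∧ F-0003 ∧ F-0405 at the genuine surface-group carrier of type `(g, r)`.**  For the
PROFINITE completion `ι : Γ_{g,r} → P` of a hyperbolic punctured surface group, the cuspidal datum on
`Π := P ↠ G := 1` with cusps `Fin r` and `D_j = I_j = cl ι⟨c_j⟩`
(`CuspidalData.exists_surfaceGroup_inertiaFreeProcyclic`) satisfies `InertiaFreeProcyclic` (`I_j ≅ Ẑ`),
`DecompEqCommensuratorOfInertia` (`D_j = C_Π(D_j ∩ Δ)`, [AbsTopI] Lem. 4.5 (vi) as typed), hence — by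
abc-iut-f-060's structure theorem `decompEqCommensuratorOfInertia_iff` — `InertiaCommensurablyTerminal`
([AbsAnab] Lem. 1.3.7 as typed) and `DecompEqNormalizer` ([AbsTopIII] Thm. 1.11 (b) as typed).
[cite: MochizukiAbsTopI2012, Lemma 4.5 (vi) p.55] -/
theorem FundamentalExtension.CuspidalData.exists_surfaceGroup_cuspidalQuartet
    (h : PuncturedSurfaceGroup.IsHyperbolicType g r) (ι : PuncturedSurfaceGroup g r →* P)
    (hι : IsProSigmaCompletion {p : ℕ | p.Prime} ι) :
    ∃ C : FundamentalExtension.CuspidalData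
        { arith := ProfiniteGrp.of P, gal := ProfiniteGrp.of PUnit.{v + 1}, aug := 1,
          aug_surjective := fun _ => ⟨1, rfl⟩ },
      ∃ e : C.Cusp ≃ Fin r,
        (∀ x, C.Dcusp x = ((PuncturedSurfaceGroup.cuspInertia (g := g) (e x)).map ι).topologicalClosure) ∧
        (∀ x, C.Icusp x = ((PuncturedSurfaceGroup.cuspInertia (g := g) (e x)).map ι).topologicalClosure) ∧
        C.InertiaFreeProcyclic ∧ C.DecompEqCommensuratorOfInertia ∧
        C.InertiaCommensurablyTerminal ∧ C.DecompEqNormalizer := by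
  obtain ⟨C, e, hD, hI, hIF⟩ :=
    FundamentalExtension.CuspidalData.exists_surfaceGroup_inertiaFreeProcyclic (P := P) h ι hι
  have hcomm : C.DecompEqCommensuratorOfInertia := fun x => by
    have hDI : C.Dcusp x ⊓ FundamentalExtension.geom _ = C.Icusp x := (C.Icusp_eq x).symm
    rw [hDI, hI x, hD x]
    exact (commensurator_cuspInertia_closure_eq ⟨2, Nat.prime_two⟩ (fun p hp => hp) h ι hι (e x)).symm
  exact ⟨C, e, hD, hI, hIF, hcomm, (C.decompEqCommensuratorOfInertia_iff.mp hcomm).1,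
    (C.decompEqCommensuratorOfInertia_iff.mp hcomm).2⟩

/-- **Hence the quartet is INHABITED by genuine cuspidal data with `r` cusps for every hyperbolic `(g, r)`**
(the profinite completion of `Γ_{g,r}` exists: `exists_isProSigmaCompletion`, [SemiAnbd] Ex. 2.10).
[cite: MochizukiAbsTopI2012, Lemma 4.5 (vi) p.55] -/
theorem FundamentalExtension.CuspidalData.exists_surfaceGroup_cuspidalQuartet_of_isHyperbolicType (g r : ℕ)
    (h : PuncturedSurfaceGroup.IsHyperbolicType g r) :
    ∃ (Q : ProfiniteGrp.{0}) (ι : PuncturedSurfaceGroup g r →* Q) (_ : IsProSigmaCompletion {p : ℕ | p.Prime} ι)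
      (E : FundamentalExtension.{0}) (C : E.CuspidalData), E.arith = Q ∧ E.geom = ⊤ ∧ Nat.card C.Cusp = r ∧
        C.InertiaFreeProcyclic ∧ C.DecompEqCommensuratorOfInertia ∧
        C.InertiaCommensurablyTerminal ∧ C.DecompEqNormalizer := by
  obtain ⟨Q, ι, hι⟩ :=
    SemiGraphOfAnabelioids.IsProSigmaCompletion.exists_isProSigmaCompletion (PuncturedSurfaceGroup g r)
      {p : ℕ | p.Prime}
  obtain ⟨C, e, -, -, hIF, hcomm, hct, hnorm⟩ :=
    FundamentalExtension.CuspidalData.exists_surfaceGroup_cuspidalQuartet (P := Q) h ι hι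
  refine ⟨Q, ι, hι, _, C, rfl, ?_, ?_, hIF, hcomm, hct, hnorm⟩
  · rw [eq_top_iff]
    intro x _
    rw [FundamentalExtension.mem_geom]
  · rw [Nat.card_congr e, Nat.card_eq_fintype_card, Fintype.card_fin]

end Literature.AnabelianGeometry.AbsoluteAnabelian
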